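import Mathlib
import Summits.QuantumFields.YangMills.Theses.PencilRigidity

/-!
# Line `null-family-sign-test` for crux `PencilRigidity.ShellRigidity` (stmt-QuantumFields-11685)

Planner skeleton (planner-cruxplan-stmt-QuantumFields-11685-null-family-sign-tes-0, 2026-08-16) of the crux idea
`Cruxes/ShellRigidity/Ideas/null-family-sign-test.md` (ideator 3; triage r1-1/2/3: pass ×3), cut as the panel asked:
step (i) "inversion / dressed Källén–Lehmann" is the first-class, hardest stub; the band-limit INPUT is one stub
(the companion card `thales-slit-exact-cone-type`'s whole lever, shared with that line); the two sign facts
(`P4P6NullIndefinite`, PROVED in `TRIAGE-r1-3-P4P6.lean`) live inside `stub_lowDegreeVanish`.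

## The line in one paragraph

Let `K` satisfy the crux hypotheses (continuous off `0`, `|K x| ≤ C(1+‖x‖^(η−10))`, `W(B₄)`-invariant, pointwise
OS-positive across `x₀ = 0` and across `x₀ = x₁`). (0) WLOG the UV exponent is `a ∈ (0,10)` (`stub_uvExponentWindow`).
(1) The two 45° mirror families make the complexified rotation angle entire of exponential type `≤ a`, so only the
Fourier modes `0, ±4, ±8` survive in every coordinate plane and the Casimir count `ℓ(ℓ+2) ≤ 6·8²` makes `K`
SO(4)-finite of degree `≤ 18` (`stub_bandLimit`, = companion card). (2) A band-limited 16-RP kernel is, off `0`, a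
finite sum of DRESSED KÄLLÉN–LEHMANN terms `H_{ℓ,i}(x) · ∫ g_ℓ(M, ‖x‖) dρ_{ℓ,i}(M)` with `W(B₄)`-invariant harmonic
dressings `H_{ℓ,i}` and SIGNED Laplace-transformable spectral weights `ρ_{ℓ,i}` on `M = m² ≥ 0`, plus a constant
(`stub_dressedKL` — the hardest stub: pencil Laplace measure of the diagonal mirror, band-limit ⇒ its boundary
distribution is a finite sum (Lorentz-invariant distribution) × (wave-harmonic polynomial), shell-wise linear
independence of the dressings (kit j007742: full rank 18/18 on the mass shells, both mirrors) + positivity ⇒ the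
invariant coefficients are MEASURES). (3) Reflection positivity across `e₀^⊥` and `d'^⊥` makes the explicit pencil
Laplace measures positive; dividing by `|p⊥|^ℓ_top` and letting `|p⊥| → ∞` on a shell shows that the TOP-degree
`V_ℓ`-valued measure `Σ_i H_{ℓ,i} ρ_{ℓ,i}` is ONE-SIGNED on the two real-null families
`N_{e₀} = {i e₀ + q̂}`, `N_{d'} = {i d' + q̂}` (`stub_topShellSign`). (4) `W(B₄)`-invariant harmonics of degree
`1 ≤ ℓ ≤ 7` exist only in degrees 4 and 6, one line each, and both change sign on `N_{e₀} ∪ N_{d'}`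
(`p₄ = −2, 3/2`; `p₆ = 3/4, −3/4`), so a one-signed top family of degree `≤ 7` has zero weights
(`stub_lowDegreeVanish`). (5) A NONZERO one-signed top family of degree `ℓ` forces `sup_{‖x‖=r} |K x| ≳ r^(−ℓ−2)`
(no Pauli–Villars cancellation in a pointed cone; Hobson `g_ℓ ≍ r^(−2ℓ−2)`; point-evaluation dual functionals
separate the degrees), hence `ℓ + 2 ≤ a < 10` (`stub_orderLaw`). Downward induction on the degree
(`anisotropic_vanish`, kernel-checked) kills every anisotropic weight: `ℓ ≥ 8` by (5), `ℓ ≤ 7` by (4); what is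
left is `K x = radial ‖x‖`, i.e. `K ∘ R = K` off `0` for every linear isometry (`ShellRigidity_of`, by name, no
hypotheses). The threshold `10 = 8 + 2` of the crux is visible as: `8` = lowest degree with a one-signed invariant
harmonic on the null families (`p₄²`; kit j007742: degrees 8, 12–18 admit one, 4, 6, 10 do not), `2` = the order law.

## Stubs (six; sorries ONLY here) and glue

`stub_uvExponentWindow` (S/M) · `stub_bandLimit` (XL, shared with the companion line) · `stub_dressedKL` (XL,
HARDEST) · `stub_topShellSign` (L) · `stub_lowDegreeVanish` (M) · `stub_orderLaw` (L). Sorry-free glue: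
`anisotropic_vanish`, `radial_of_vanish`, `bandLimited_radial` (= the card's Transfer target `C⁺ =
BandLimitedShellRigidity`, arrow form), `ShellRigidity_of : PencilRigidity.ShellRigidity`.

## Seam with the companion line `Lines/thales-slit-exact-cone-type.lean` (published 2026-08-16, same crux)

The two ideator-3 lines are ONE line cut at the band-limit seam, and the two skeletons were typed to fit: the
companion's S4 `stub_so4Finite` concludes VERBATIM the body of `IsBandLimited 18 K` below, so its S0–S4
(`stub_boundedOfGrowth`, `stub_laplace`, `stub_thalesSlit`, `stub_cone_of_slitSections`, `stub_angleBandLimit`,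
`stub_so4Finite` + glue `decayWindow`, `laplace_e0`) PROVE `stub_uvExponentWindow` + `stub_bandLimit` here; conversely
the sorry-free arrow `bandLimited_radial` here (stubs 2–5) proves its S5 `stub_bandLimitedRigidity`, whose extra
inputs (the crux's RP clauses rewritten as the tree's `IsMirrorRPKernel e₀ K` / `IsMirrorRPKernel (e₀−e₁) K` by its
glue `isMirrorRPKernel_e0` / `isMirrorRPKernel_e0_sub_e1`, and the `e₀`-Laplace measure with its exact `ℓ∞` light
cone) are exactly what the prover of `stub_dressedKL` wants as landed helpers. A lead holding both files works the
front end there and the back end here.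

## Vocabulary

Transparent local definitions (there is no tree notion for any of them yet): `Hyp16 a K` (= `Ideator3.Hyp16`, the
crux hypotheses with exponent `a`), `IsBandLimited L K`, `IsInvHarmonic ℓ H` (`W(B₄)`-invariant harmonic
homogeneous polynomial of degree `ℓ`, over `MvPolynomial (Fin 4) ℝ`), the Hobson kernel `gKer ℓ M r`,
`IsSpectralWeight ρ` (positive measure on `[0,∞)`, Laplace-transformable in `√M`), the record `DKLData` with
`DKLData.Represents d K`, the diagonal normal `dg = (e₀ − e₁)/√2` of the crux's swap mirror, the complex null
point `nullPt n q = i n + q`, and `OneSignedFamily H ρp ρm`. Signed spectral weights are carried as pairs of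
(possibly infinite) positive measures `ρp, ρm` ("`ρ = ρp − ρm`"; Mathlib's `SignedMeasure` is finite, ours need
not be); "`ρ = 0`" is spelled `ρp = ρm`. A lead who wants the vocabulary tracked files it under
`Literature/MathematicalPhysics/QuantumFieldTheory/` next to `MirrorRPKernel` (kernel RP API, PROVED there:
`IsMirrorRPKernel`, isometry transport, Gram criterion) — nothing here depends on where it lives.

## Disproof.lean

Does not exist for this crux at session time (payload `disproof_path`
`run/sessions/refuter-cdisprove-stmt-QuantumFields-11685-0/folder/Disproof.lean` and the publish path
`Cruxes/ShellRigidity/Disproof.lean` are both absent; `ledger crux ls` lists none). No `_false_without_` theorem or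
`Negative/` lemma to honour or import. Load-bearing hypotheses, for the future disprover: the DIAGONAL mirror is
consumed twice (`stub_bandLimit`: Thales disc; `stub_topShellSign`/`stub_lowDegreeVanish`: the family `N_{d'}`,
where degree 4 dies — with the axis family alone `p₄ > 0` on `N_{e₀}` and the line would wrongly pass degree 4,
cf. `PencilRigidity.AxisMirrorsInsufficient`, zoo Z1); the AXIS mirror is consumed in `stub_bandLimit` (the `e₁`
Laplace bound) and in `stub_lowDegreeVanish` (degree 6 dies on `N_{e₀}`: `p₆ ≤ 0` there, `> 0` at `i d' + e₂`);
the UV exponent enters only `stub_bandLimit` (type bound) and `stub_orderLaw` (`ℓ + 2 ≤ a`).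

Evidence: kit j007722 (smoke) and j007742 (attached to stmt-QuantumFields-11685): dimensions of invariant
harmonics per degree ≤ 18 (1,0,1,1,2,1,3,2,4,3), FULL shell rank 18/18 on the mass shells `M ∈ {0,1}` for both
mirror normals `e₀`, `d'` (triage r1-2's rank drop concerns fixed-`|k⊥|` spheres only), the null-family sign table
(one-signed invariant harmonic exists in degree 8, 12, 14, 16, 18; not in 4, 6, 10) and the four `P4P6` values.
-/

noncomputable section

namespace Summit.QuantumFields.YangMills.Cruxes.ShellRigidity.NullFamilySignTest

open MeasureTheory Complex Set Filter
open Literature.MathematicalPhysics.QuantumLattice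
open Summit.QuantumFields.YangMills.Theses.PencilRigidity

set_option linter.unusedVariables false

local notation "E4" => EuclideanSpace ℝ (Fin 4)

/-! ## Vocabulary -/

/-- The hypothesis package of `ShellRigidity` with a general UV exponent `a` (the crux has `a = 10 − η`):
continuity off `0`, `|K x| ≤ C (1 + ‖x‖^(−a))` off `0`, invariance under every signed permutation (`W(B₄)`,
spelled as in the crux), pointwise OS-positivity across `x₀ = 0` (`timeReflection 4`, side `0 < x⁰`) and across
`x₀ = x₁` (`piLpCongrLeft (swap 0 1)`, side `x¹ < x⁰`) — literally the crux's clauses. Same as `Ideator3.Hyp16`. -/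
def Hyp16 (a : ℝ) (K : E4 → ℝ) : Prop :=
  ContinuousOn K {x : E4 | x ≠ 0} ∧
  (∃ C : ℝ, ∀ x : E4, x ≠ 0 → |K x| ≤ C * (1 + ‖x‖ ^ (-a))) ∧
  (∀ R : E4 ≃ₗᵢ[ℝ] E4, (∀ i : Fin 4, ∃ j : Fin 4,
      R (EuclideanSpace.single i 1) = EuclideanSpace.single j 1 ∨
      R (EuclideanSpace.single i 1) = -EuclideanSpace.single j 1) → ∀ x : E4, K (R x) = K x) ∧
  (∀ (m : ℕ) (x : Fin m → E4) (c : Fin m → ℝ), (∀ i, 0 < x i 0) →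
    0 ≤ ∑ i, ∑ j, c i * c j * K (timeReflection 4 (x i) - x j)) ∧
  (∀ (m : ℕ) (x : Fin m → E4) (c : Fin m → ℝ), (∀ i, x i 1 < x i 0) →
    0 ≤ ∑ i, ∑ j, c i * c j *
      K (LinearIsometryEquiv.piLpCongrLeft 2 ℝ ℝ (Equiv.swap (0 : Fin 4) 1) (x i) - x j))

/-- `K` is BAND-LIMITED of degree `≤ L` (SO(4)-finite): off the origin it is a finite sum of
(function of the radius) × (polynomial of total degree `≤ L`). -/
def IsBandLimited (L : ℕ) (K : E4 → ℝ) : Prop :=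
  ∃ (N : ℕ) (k : Fin N → ℝ → ℝ) (P : Fin N → MvPolynomial (Fin 4) ℝ),
    (∀ j, (P j).totalDegree ≤ L) ∧
    ∀ x : E4, x ≠ 0 → K x = ∑ j, k j ‖x‖ * MvPolynomial.eval (fun i => x i) (P j)

/-- `H` is a `W(B₄)`-INVARIANT HARMONIC homogeneous polynomial of degree `ℓ` on `ℝ⁴`: homogeneous of degree `ℓ`,
`Σ_μ ∂_μ² H = 0`, and `H(s₀ x_{σ0}, …, s₃ x_{σ3}) = H(x)` for every permutation `σ` and signs `sᵢ = ±1`.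
(Dimensions per degree `0,2,4,…,18`: `1,0,1,1,2,1,3,2,4,3` — Molien `1/((1−t⁴)(1−t⁶)(1−t⁸))`, kit j007742;
degree 4: `p₄ − p₂²/2`, degree 6: `∝ p₆ mod p₂`.) -/
def IsInvHarmonic (ℓ : ℕ) (H : MvPolynomial (Fin 4) ℝ) : Prop :=
  H.IsHomogeneous ℓ ∧
  (∑ μ : Fin 4, MvPolynomial.pderiv μ (MvPolynomial.pderiv μ H)) = 0 ∧
  ∀ (σ : Equiv.Perm (Fin 4)) (s : Fin 4 → ℝ), (∀ i, s i = 1 ∨ s i = -1) →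
    MvPolynomial.aeval (fun i => MvPolynomial.C (s i) * MvPolynomial.X (σ i)) H = H

/-- HOBSON RADIAL KERNEL `g_ℓ(M, r) = ∫₀^∞ (4πτ)⁻² (4τ)^(−ℓ) exp(−r²/(4τ) − M τ) dτ = (−∂_s)^ℓ|_{s=r²} G_{√M}`:
`g₀(m², r) = G_m(r) = m K₁(m r)/(4π² r)` is the free covariance of mass `m` on `ℝ⁴` (Schwinger parametrisation),
and for a harmonic homogeneous `H` of even degree `ℓ` Hobson's formula `H(∂)[F(r²)] = 2^ℓ H(x) F^{(ℓ)}(r²)` gives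
`H(−i∇) G_m (x) = (−1)^(ℓ/2) 2^ℓ H(x) g_ℓ(m², ‖x‖)` off `0`. Positive, decreasing in `M`,
`g_ℓ(M, r) ≥ c_ℓ r^(−2−2ℓ)` for `r² M ≤ 1`, and `≤ C_ℓ(r) e^{−r√M/2}`. -/
def gKer (ℓ : ℕ) (M r : ℝ) : ℝ :=
  ∫ τ in Set.Ioi (0 : ℝ), ((4 * Real.pi * τ) ^ 2)⁻¹ * ((4 * τ) ^ ℓ)⁻¹ *
    Real.exp (-(r ^ 2 / (4 * τ)) - M * τ)

/-- A positive measure on the mass variable `M = m² ∈ [0, ∞)` that is Laplace-transformable in `√M`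
(one Jordan part of a signed, possibly infinite, spectral weight; finite on bounded sets). -/
def IsSpectralWeight (ρ : Measure ℝ) : Prop :=
  ρ (Set.Iio 0) = 0 ∧
    ∀ t : ℝ, 0 < t → (∫⁻ M, ENNReal.ofReal (Real.exp (-(t * Real.sqrt M))) ∂ρ) < ⊤

/-- DRESSED KÄLLÉN–LEHMANN DATA: a constant `c₀`, a signed radial spectral weight `ρ0p − ρ0m`, and for each
degree `ℓ` finitely many anisotropic terms: an invariant harmonic dressing `H ℓ i` with a signed spectral weight
`ρp ℓ i − ρm ℓ i`. -/
structure DKLData where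
  /-- degree bound: no anisotropic term above `D` -/
  D : ℕ
  /-- the constant term (the `λ = 0` atom of the pencil Laplace measures) -/
  c₀ : ℝ
  /-- Jordan parts of the radial (degree-0) spectral weight -/
  ρ0p : Measure ℝ
  ρ0m : Measure ℝ
  /-- number of anisotropic terms in degree `ℓ` (zero for `ℓ = 0` and for `ℓ > D`) -/
  m : ℕ → ℕ
  /-- the dressings of degree `ℓ` (linearly independent for fixed `ℓ`) -/
  H : (ℓ : ℕ) → Fin (m ℓ) → MvPolynomial (Fin 4) ℝ
  /-- Jordan parts of the signed spectral weights of the anisotropic terms -/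
  ρp : (ℓ : ℕ) → Fin (m ℓ) → Measure ℝ
  ρm : (ℓ : ℕ) → Fin (m ℓ) → Measure ℝ

/-- The radial part `c₀ + ∫ G_{√M}(r) d(ρ0p − ρ0m)(M)`. -/
def DKLData.radial (d : DKLData) (r : ℝ) : ℝ :=
  d.c₀ + (∫ M, gKer 0 M r ∂d.ρ0p) - ∫ M, gKer 0 M r ∂d.ρ0m

/-- The radial profile of the anisotropic term `(ℓ, i)`: `∫ g_ℓ(M, r) d(ρp − ρm)(M)`. -/
def DKLData.prof (d : DKLData) (ℓ : ℕ) (i : Fin (d.m ℓ)) (r : ℝ) : ℝ :=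
  (∫ M, gKer ℓ M r ∂(d.ρp ℓ i)) - ∫ M, gKer ℓ M r ∂(d.ρm ℓ i)

/-- `d` REPRESENTS `K` off the origin: the data are well formed (spectral weights, no anisotropic term in degree
`0` or above `D`, dressings `W(B₄)`-invariant harmonic of the right degree and linearly independent per degree)
and `K x = radial ‖x‖ + Σ_{ℓ ≤ D} Σ_i H_{ℓ,i}(x) · prof_{ℓ,i}(‖x‖)` for every `x ≠ 0`. -/
structure DKLData.Represents (d : DKLData) (K : E4 → ℝ) : Prop where
  radial_p : IsSpectralWeight d.ρ0p
  radial_m : IsSpectralWeight d.ρ0m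
  m_zero : d.m 0 = 0
  m_above : ∀ ℓ, d.D < ℓ → d.m ℓ = 0
  invHarm : ∀ (ℓ : ℕ) (i : Fin (d.m ℓ)), IsInvHarmonic ℓ (d.H ℓ i)
  linIndep : ∀ ℓ : ℕ, LinearIndependent ℝ (d.H ℓ)
  weight : ∀ (ℓ : ℕ) (i : Fin (d.m ℓ)), IsSpectralWeight (d.ρp ℓ i) ∧ IsSpectralWeight (d.ρm ℓ i)
  eq : ∀ x : E4, x ≠ 0 →
    K x = d.radial ‖x‖ +
      ∑ ℓ ∈ Finset.range (d.D + 1), ∑ i : Fin (d.m ℓ),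
        MvPolynomial.eval (fun μ => x μ) (d.H ℓ i) * d.prof ℓ i ‖x‖

/-- The unit normal `d' = (e₀ − e₁)/√2` of the crux's diagonal mirror `x₀ = x₁`
(`piLpCongrLeft (swap 0 1)` is the reflection in `d'^⊥`; the positive side `x¹ < x⁰` is `0 < ⟪x, d'⟫`). -/
def dg : E4 := (Real.sqrt 2)⁻¹ • (EuclideanSpace.single 0 1 - EuclideanSpace.single 1 1)

/-- The complex null vector `i n + q ∈ ℂ⁴` (for `q ⊥ n`, `‖q‖ = ‖n‖ = 1`: `(in+q)·(in+q) = 0`). -/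
def nullPt (n q : E4) : Fin 4 → ℂ := fun μ => (n μ : ℂ) * Complex.I + (q μ : ℂ)

/-- ONE-SIGNEDNESS of a dressed family on the two real-null families. For a family of dressings `H i` with
signed weights `ρp i − ρm i`: there is ONE sign `ε = ±1` such that for every bounded Borel `B ⊆ [0, T]` the
harmonic `H_B := ε Σ_i (ρp i B − ρm i B) H i` is `≥ 0` on `N_{e₀} = {i e₀ + q̂ : q̂ ⊥ e₀, ‖q̂‖ = 1}` and on
`N_{d'} = {i d' + q̂ : q̂ ⊥ d', ‖q̂‖ = 1}` (real parts tested; the values are real because `H` is even under the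
mirror `θ_n ∈ W(B₄)` and `θ_n(in + q̂) = conj(in + q̂)`). Bounded-set form of "the `V_ℓ`-valued measure
`Σ_i H_i (ρp_i − ρm_i)` takes values in `ε 𝒦_ℓ`, `𝒦_ℓ = {H ≥ 0 on N_{e₀} ∪ N_{d'}}`". -/
def OneSignedFamily {m : ℕ} (H : Fin m → MvPolynomial (Fin 4) ℝ) (ρp ρm : Fin m → Measure ℝ) : Prop :=
  ∃ ε : ℝ, (ε = 1 ∨ ε = -1) ∧ ∀ (T : ℝ) (B : Set ℝ), MeasurableSet B → B ⊆ Set.Icc 0 T →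
    (∀ q : E4, inner ℝ q (EuclideanSpace.single 0 1 : E4) = 0 → ‖q‖ = 1 →
      0 ≤ (MvPolynomial.aeval (nullPt (EuclideanSpace.single 0 1) q)
        (ε • ∑ i, (((ρp i) B).toReal - ((ρm i) B).toReal) • H i)).re) ∧
    (∀ q : E4, inner ℝ q dg = 0 → ‖q‖ = 1 →
      0 ≤ (MvPolynomial.aeval (nullPt dg q)
        (ε • ∑ i, (((ρp i) B).toReal - ((ρm i) B).toReal) • H i)).re)

/-! ## The six stubs -/

/-- **Stub 0 — UV exponent window (triage r1-1 (C1) "self-improvement"; size S/M).** The crux allows any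
`η > 0` in `|K x| ≤ C(1 + ‖x‖^(η−10))`; every later stub wants the exponent `a = 10 − η` in the window
`0 < a < 10` with the bound `C(1 + ‖x‖^(−a))`. For `η < 10` take `a = 10 − η` (nothing to do). For `η ≥ 10`
the bound allows polynomial GROWTH and must be improved to boundedness, which RP supplies: at purely temporal
points `f(s) := K(s e₀)` is continuous and exponentially convex (`Σ cᵢcⱼ f(tᵢ+tⱼ) ≥ 0` from the `x₀ = 0` clause
and `K(−t e₀) = K(t e₀)`), hence a two-sided Laplace transform `∫ e^{−λs} dν(λ)` (Bernstein–Widder; BCR Ch. 6),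
the polynomial bound kills `ν` on `λ < 0`, so `f` is decreasing; the `2 × 2` Gram inequality of the same clause
gives `|K(t e₀ + y)| ≤ f(t)` for spatial `y`, and `W(B₄)` gives `|K x| ≤ f(‖x‖_∞)`: `K` is bounded on
`{‖x‖ ≥ 1}`, hence `|K x| ≤ C'(1 + ‖x‖^(−1))` off `0`, i.e. `a = 1` works. Leans on: Mathlib only
(Bernstein–Widder is NOT in Mathlib: either prove the bounded/decreasing consequence directly from exponential
convexity + continuity + polynomial growth, or vendor it as a cited Literature fact). -/
theorem stub_uvExponentWindow (K : E4 → ℝ)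
    (h1 : ContinuousOn K {x : E4 | x ≠ 0})
    (h2 : ∃ C η : ℝ, 0 < η ∧ ∀ x : E4, x ≠ 0 → |K x| ≤ C * (1 + ‖x‖ ^ (η - 10)))
    (h3 : ∀ R : E4 ≃ₗᵢ[ℝ] E4, (∀ i : Fin 4, ∃ j : Fin 4,
        R (EuclideanSpace.single i 1) = EuclideanSpace.single j 1 ∨
        R (EuclideanSpace.single i 1) = -EuclideanSpace.single j 1) → ∀ x : E4, K (R x) = K x)
    (h4 : ∀ (m : ℕ) (x : Fin m → E4) (c : Fin m → ℝ), (∀ i, 0 < x i 0) →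
        0 ≤ ∑ i, ∑ j, c i * c j * K (timeReflection 4 (x i) - x j))
    (h5 : ∀ (m : ℕ) (x : Fin m → E4) (c : Fin m → ℝ), (∀ i, x i 1 < x i 0) →
        0 ≤ ∑ i, ∑ j, c i * c j *
          K (LinearIsometryEquiv.piLpCongrLeft 2 ℝ ℝ (Equiv.swap (0 : Fin 4) 1) (x i) - x j)) :
    ∃ a : ℝ, 0 < a ∧ a < 10 ∧ Hyp16 a K := by
  sorry

/-- **Stub 1 — band limit `ℓ ≤ 18` (the companion card `thales-slit-exact-cone-type`'s lever = this line's
INPUT; size XL; shared verbatim with that line, triage r1-1/2/3 pass).** For `0 < a < 10` and `Hyp16 a K`, `K` is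
SO(4)-finite of degree `≤ 18` off `0`. Why true: (1) `e₁`-pencil Laplace representation (BCR Thm 4.2.8 on the
half-space semigroup, or OS reconstruction as in the tree's `OSReconstructionNoE1`) ⇒ `u ↦ K(t e₀ + u e₁ + x′)`
extends holomorphically off the imaginary axis with `|G(u+iY)| ≤ K(|u| e₁) ≤ C(1 + |u|^(−a))`; (2) the two DIAGONAL
mirrors, as the two slots of the tree's sector engine `LogSlot.IsSectorData.exists_extension` (m = 1, a = π/2,
`OSSectorContinuation.lean:439`, maximum principle `:596`), continue it to the Thales disc `|w| < t`; (3) slit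
estimate (log-subharmonicity on circles, `∫ log|cos θ| = −2π log 2`) + Landau–Pringsheim on the `p₁`-marginal of
`e^{−λt} μ₀` ⇒ the axis Laplace measure `μ₀` is carried by the EXACT `ℓ∞` cone `λ ≥ |p⃗|_∞`; (4) hence `K` is
holomorphic on the tube `{Re z₀ > |Im z⃗|₁}` with `|K z| ≤ K((Re z₀ − |Im z⃗|₁) e₀)`, which contains the complex
rotation orbit `R_{α+iψ} x` with margin `(R_α x)₀ e^{−|ψ|}`: `φ ↦ K(R_φ x)` (rotation of the `(0,1)`-plane) is
ENTIRE of exponential type `≤ a`, `π/2`-periodic (`R_{π/2} ∈ W(B₄)`), so by contour shift only the modes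
`e^{4ijφ}` with `4|j| ≤ a < 10`, i.e. `j ∈ {0, ±1, ±2}`, survive; (5) the same in all six coordinate planes
(`W(B₄)` conjugation), and on each sphere the degree-`ℓ` spherical-harmonic component of `K(r·)` (the projection
commutes with rotations) satisfies `ℓ(ℓ+2)‖f_ℓ‖² = Σ_{μ<ν} ‖L_{μν} f_ℓ‖² ≤ 6·64 ‖f_ℓ‖²`, so `f_ℓ = 0` for `ℓ ≥ 19`;
expanding `K(r x̂) = Σ_{ℓ≤18,m} c_{ℓm}(r) Y_{ℓm}(x̂) = Σ c_{ℓm}(r) r^(−ℓ) Y_{ℓm}(r x̂)` is the stated form.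
Calibration: `a < 4` ⇒ modes `{0}` ⇒ radial at once (the refuters' proved sub-case `η > 8`, improved to `η > 6`).
Leans on: `LogSlot.IsSectorData.exists_extension`/`norm_extension_le` (PROVED), `MirrorRPKernel` API,
`Literature.Analysis.Fourier.CharFunHalfPlaneSupport` (one-sided Paley–Wiener); printed only: BCR 4.2.8,
Widder II §5 Thm 5b / Lukacs 7.1.1 (Landau–Pringsheim), Stein–Weiss IV (spherical harmonics; ad hoc for the
finitely many degrees is fine). -/
theorem stub_bandLimit (a : ℝ) (K : E4 → ℝ) (ha : 0 < a) (ha' : a < 10) (hK : Hyp16 a K) :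
    IsBandLimited 18 K := by
  sorry

/-- **Stub 2 — dressed Källén–Lehmann normal form (the card's step (i) "inversion"; the HARDEST stub, the one the
triage panel asked to see first; size XL).** A band-limited kernel with `Hyp16 a K` is, off `0`,
`K x = c₀ + ∫ G_{√M}(‖x‖) dρ₀(M) + Σ_{1≤ℓ≤D} Σ_i H_{ℓ,i}(x) ∫ g_ℓ(M, ‖x‖) dρ_{ℓ,i}(M)` with `W(B₄)`-invariant harmonic
dressings `H_{ℓ,i}` (linearly independent per degree) and SIGNED spectral weights `ρ = ρp − ρm` on `M ≥ 0`,
Laplace-transformable in `√M` (all tachyon-free, all shells isotropic, no subtractions needed off `0`).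
Suggested route (x-space/Laplace side — NOT through `K̂`, which does not exist as a function: `K ∉ L¹_loc` for
`a ≥ 4`, triage r1-2/r1-3): (a) isotypic split `K = Σ_{ℓ≤18} Σ_i Φ_{ℓ,i}(r) H_{ℓ,i}(x)` with `Φ_{ℓ,i}` continuous
(project `K(r·)` on a basis of invariant harmonics; `W(B₄)`-invariance of `K` keeps only invariant ones);
(b) radial analyticity: on each of the 8 caps `{±x̂_μ ≥ 1/2}` the pencil Laplace representation makes
`r ↦ K(r x̂)` holomorphic on `Re r > 0` with `|K(r x̂)| ≤ C(1 + (Re r/2)^(−a))`, so every `Φ_{ℓ,i}` is holomorphic on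
the right half-plane, i.e. `K` extends to `{z ∈ ℂ⁴ : z·z ∉ (−∞,0]}`; (c) the `d'`-pencil Laplace measure `μ_{d'} ≥ 0`
(BCR / OS reconstruction across the diagonal mirror; tempered because `K(t d') ≤ C(1+t^(−a))`) has Fourier transform
the boundary distribution `W(t, x⊥) = lim_{ε↓0} K((ε+it) d' + x⊥) = Σ_{ℓ,i} w_{ℓ,i}(x·x) H_{ℓ,i}(it d' + x⊥)` — a FINITE
sum of (boost-invariant distribution) × (wave-harmonic polynomial) — so `μ_{d'} = Σ_{ℓ,i} H_{ℓ,i}(iλ d' + p)·ρ̃_{ℓ,i}`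
with `ρ̃_{ℓ,i}` one-variable distributions in the invariant `M = λ² − |p|²`, supported in `M ≥ 0` (boost-invariant
distributions carried by `λ ≥ 0` have no `M < 0` part; the tip `M = λ = 0` contributes the constant `c₀`, any other
polynomial being excluded by the bound); (d) SHELL-WISE LINEAR INDEPENDENCE of the functions
`p ↦ H_{ℓ,i}(i√(M+|p|²) d' + p)` on `d'^⊥` for every `M ≥ 0` (kit j007742: rank 18/18 at `M = 0, 1`, all invariant
harmonics of degree ≤ 18 jointly; also 18/18 along `e₀`) lets smooth shell-wise dual functions `g_k(M,p)` test
`μ_{d'} ≥ 0` against `χ(M) g_k(M,p)`: each `ρ̃_{ℓ,i}` is a distribution of ORDER 0, i.e. a signed Radon measure,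
Laplace-transformable because `μ_{d'}` is; (e) Hobson's formula and the half-space Fourier representation of
`H(−i∇) G_m` identify the x-space profiles with `∫ g_ℓ dρ` (constants `(−1)^(ℓ/2) 2^ℓ` absorbed into `ρ`).
Where it can die (triage doubt, recorded): (c)–(d) near the massless shell `M = 0` and at the tip; if a genuine
band-limited 16-RP kernel had a non-measure invariant coefficient (`δ′(M)`-type, profile `∝ r^(−2ℓ)`) positivity in
(d) must exclude it — it does iff the dual functions extend smoothly across `M = 0`, which the rank certificate at
`M = 0` supports. Leans on: `MirrorRPKernel` (RP API), `OSReconstructionNoE1` (semigroup + joint spectral measure,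
PROVED `exists_isJointSpectralMeasure_holds`) or BCR 4.2.8 (printed), Mathlib `MvPolynomial`, `MeasureTheory`;
printed only: Hobson's theorem (Stein–Weiss IV §2), structure of invariant distributions (Methée 1954 /
Gårding–Lions 1959) — or avoided by the one-variable Cauchy-transform route of the card (each `Φ_{ℓ,i}(√s)` is
holomorphic on `ℂ ∖ (−∞,0]` with polynomial bounds, hence a subtracted Cauchy integral of its discontinuity). -/
theorem stub_dressedKL (a : ℝ) (K : E4 → ℝ) (ha : 0 < a) (hK : Hyp16 a K)
    (hb : IsBandLimited 18 K) : ∃ d : DKLData, d.Represents K := by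
  sorry

/-- **Stub 3 — positivity transfer + large-`|p⊥|` DOMINANCE: the top family is one-signed on the null families
(the card's fact (ii); size L).** If `d` represents `K`, `Hyp16 a K`, `ℓ ≥ 1` and every anisotropic weight of
degree `> ℓ` vanishes, then the degree-`ℓ` family `(H ℓ i, ρp ℓ i − ρm ℓ i)` is one-signed on `N_{e₀} ∪ N_{d'}`
with one common sign `ε`. Why true: (1) for `n ∈ {e₀, d'}` each term has an EXPLICIT half-space Fourier–Laplace
representation: `H(x) g_ℓ(M,‖x‖) = (−1)^(ℓ/2) 2^(−ℓ) H(−i∇) G_{√M}(x)` and, for `x·n > 0`,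
`G_m(x) = (2π)⁻³ ∫_{n^⊥} e^{ip·x⊥ − ω x·n}/(2ω) dp`, `ω = √(m² + |p|²)`, so
`K(x) = ∫ e^{−λ x·n + i p·x⊥} dS_n(λ,p)` with the SIGNED measure
`S_n = c₀ δ₀ + Σ_{ℓ′,i} (−1)^(ℓ′/2) 2^(−ℓ′) (2π)⁻³ (H_{ℓ′,i}(iω n + p)/(2ω)) · (ρ_{ℓ′,i}(dM) ⊗ dp)∘(M,p ↦ (ω,p))⁻¹`
(Fubini; absolutely convergent for `x·n > 0` by the spectral-weight condition); (2) POSITIVITY TRANSFER: the RP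
clause across `n^⊥` (after `K ∘ θ_n = K`, `θ_n ∈ W(B₄)`) reads `∫ |Σ_a c_a e^{−λ s_a + i p·y_a}|² dS_n ≥ 0`; with
product configurations the integrands are `|P(λ)|² |Q(p)|²` (`P` real exponential polynomial, `Q` trigonometric
polynomial); Bochner uniqueness in `p` (`Measure.ext_of_charFun`) and Stone–Weierstrass in `u = e^{−λ}` on `[0,1]`
(squares `u² p(u)²` approximate `u² g`, `g ≥ 0`) give `S_n ≥ 0` on measurable rectangles, hence `S_n ≥ 0`
(no BCR needed); (3) DOMINANCE: test `S_n ≥ 0` against `χ(λ² − |p|²) ψ(p − c q̂)` (`χ ≥ 0` supported in `[0,T]`,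
`ψ ≥ 0` a bump, `q̂ ⊥ n` unit) and let `c → ∞`: `H_{ℓ′,i}(iω n + c q̂ + u) = c^{ℓ′} (H_{ℓ′,i}(i n + q̂) + O(1/c))`
uniformly for bounded `M, u`, and `1/(2ω) ∼ 1/(2c)`; the degree-`ℓ` terms dominate (degrees `> ℓ` have zero
weight by `htop`, the radial part and `c₀ δ₀` are degree `0 < ℓ`), so dividing by `c^(ℓ−1)` gives
`(−1)^(ℓ/2) Σ_i H_{ℓ,i}(in + q̂) ρ_{ℓ,i}(χ) ≥ 0` for all `χ`, i.e. the claim with `ε = (−1)^(ℓ/2)` (odd `ℓ`: the family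
is empty, `IsInvHarmonic ℓ H` forces `H = 0` since `−1 ∈ W(B₄)`, and independence forces `m ℓ = 0`). Values are
real: `θ_n(in + q̂) = −in + q̂ = conj(in + q̂)` and `H ∘ θ_n = H` with real coefficients.
Leans on: Mathlib `MeasureTheory.Measure.ext_of_charFun` / `charFun`, `Polynomial` Stone–Weierstrass
(`polynomialFunctions.topologicalClosure`), product measures / `Measure.map`, dominated convergence;
`MirrorRPKernel.isMirrorRPKernel_neg_arg_iff`-style rewriting of the crux's RP clauses (`timeReflection 4` is the
reflection in `e₀^⊥`, `piLpCongrLeft (swap 0 1)` the reflection in `dg^⊥`). -/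
theorem stub_topShellSign (a : ℝ) (K : E4 → ℝ) (d : DKLData) (ℓ : ℕ) (ha : 0 < a)
    (hK : Hyp16 a K) (hd : d.Represents K) (hℓ : 1 ≤ ℓ)
    (htop : ∀ ℓ' : ℕ, ℓ < ℓ' → ∀ i : Fin (d.m ℓ'), d.ρp ℓ' i = d.ρm ℓ' i) :
    OneSignedFamily (d.H ℓ) (d.ρp ℓ) (d.ρm ℓ) := by
  sorry

/-- **Stub 4 — the NULL-FAMILY SIGN TEST kills degrees `1 … 7` (the card's fact (iii) + its First lemma
`P4P6NullIndefinite`, PROVED in `TRIAGE-r1-3-P4P6.lean`; size M).** A linearly independent family of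
`W(B₄)`-invariant harmonics of degree `ℓ ∈ [1,7]` with spectral weights that is one-signed on `N_{e₀} ∪ N_{d'}` has
ZERO weights. Why true: (1) invariant theory by hand: a `W(B₄)`-invariant polynomial has only even exponents and is
symmetric, so in degrees `1,2,3,5,7` the invariant HARMONICS are `{0}` (`p₂` is not harmonic), in degree 4 they
are `ℝ·h₄`, `h₄ = p₄ − p₂²/2`, in degree 6 `ℝ·h₆`, `h₆ ≡ γ p₆ (mod p₂)`, `γ ≠ 0` (a harmonic divisible by `r²` is `0`);
hence `m ≤ 1` and for `m = 1`, `H 0 = c·h_ℓ`, `c ≠ 0`; (2) on the null cone `p₂ = 0`, so `h₄ = p₄`, `h₆ = γ p₆` there,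
and the four evaluations `p₄(i d' + d) = −2 < 0 < 3/2 = p₄(i d' + e₂)`, `p₆(i d' + e₂) = 3/4 > 0 > −3/4 =
p₆(i e₀ + (e₁+e₂)/√2)` (`d = (e₀+e₁)/√2 ⊥ d'`; `TRIAGE-r1-3-P4P6.lean`, kit j007742) show that `± w·h_ℓ ≥ 0` on both
families forces `w = 0`; (3) so for every bounded Borel `B`, `ρp 0 B = ρm 0 B` (both finite: spectral weights are
finite on bounded sets), and two measures vanishing on `(−∞,0)` that agree on all bounded Borel subsets of `[0,∞)`
are equal (continuity from below). Note BOTH families are needed: `p₄ > 0` on all of `N_{e₀}` (degree 4 dies only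
on the diagonal family) and `p₆ ≤ 0` on all of `N_{e₀}` (degree 6 needs the point `i d' + e₂`).
Leans on: Mathlib `MvPolynomial.IsHomogeneous`, `MvPolynomial.IsSymmetric`/`esymm`–`psum` API (or a direct
coefficient computation in degrees ≤ 7), `Measure.ext_of_Ioc`/`Measure.ext_of_generateFrom_of_iUnion`;
`TRIAGE-r1-3-P4P6.lean` (the complex arithmetic, reusable verbatim). -/
theorem stub_lowDegreeVanish (ℓ : ℕ) (hℓ : 1 ≤ ℓ) (hℓ7 : ℓ ≤ 7) {m : ℕ}
    (H : Fin m → MvPolynomial (Fin 4) ℝ) (hH : ∀ i, IsInvHarmonic ℓ (H i))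
    (hli : LinearIndependent ℝ H) (ρp ρm : Fin m → Measure ℝ)
    (hρ : ∀ i, IsSpectralWeight (ρp i) ∧ IsSpectralWeight (ρm i))
    (hsign : OneSignedFamily H ρp ρm) : ∀ i, ρp i = ρm i := by
  sorry

/-- **Stub 5 — the ORDER LAW `ℓ_top + 2 ≤ a` (the card's no-cancellation + degree separation; size L).** If `d`
represents `K`, `Hyp16 a K`, degree `ℓ ≥ 1` is the top (weights above `ℓ` vanish), the degree-`ℓ` family is
one-signed and NOT zero, then `ℓ + 2 ≤ a`. Why true: (1) NO CANCELLATION: the `V`-valued measure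
`ν = Σ_i H_{ℓ,i} (ρp_{ℓ,i} − ρm_{ℓ,i})` (`V = span_i H_{ℓ,i}`) is nonzero (linear independence) and takes values in
the closed cone `ε𝒦`, `𝒦 = {H ∈ V : H ≥ 0 on N_{e₀} ∪ N_{d'}}`, which is POINTED: an `H ∈ V` vanishing on `N_{e₀}`
is `0` (write `H(x₀, q) = Σ_k x₀^k h_k(q)`; harmonicity gives `h_{k+2} = −Δ h_k/((k+1)(k+2))`; `Re H(i e₀ + q̂) =
Σ_j Δ^j h₀(q̂)/(2j)! = 0` on `S²` ⇒ (parity + homogenisation) `Σ_j |q|^{2j} Δ^j h₀/(2j)! ≡ 0` ⇒ applying `Δ^s`,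
`s` maximal with `Δ^s h₀ ≠ 0`, a POSITIVE multiple of `Δ^s h₀` vanishes ⇒ `h₀ = 0`; likewise `h₁ = 0` from the
imaginary part; so `H = 0`) — hence a strictly positive functional `Λ` on `𝒦 ∖ 0` exists and
`‖∫ g_ℓ(M,r) dν(M)‖ ≥ c ∫ g_ℓ(M,r) d(Λ∘ν)(M)` with `Λ∘ν ≥ 0` nonzero; (2) HOBSON ASYMPTOTICS: `g_ℓ(M,r) ≥
c_ℓ r^(−2ℓ−2)` for `r²M ≤ 1` (restrict the `τ`-integral to `[r²/4, r²/2]`), so `‖Σ_i prof_{ℓ,i}(r) H_{ℓ,i}‖_V ≥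
c′ r^(−2ℓ−2) (Λ∘ν)([0,T])` for `r ≤ T^(−1/2)`; (3) DEGREE SEPARATION without `L²(S³)`: the finitely many functions
`1, H_{ℓ′,i}|_{S³}` (`ℓ′ ≤ ℓ`) are linearly independent, so point-evaluation dual functionals
`L_i(f) = Σ_s α_{i,s} f(x̂_s)` with `L_i(1) = 0`, `L_i(H_{ℓ′,i′}) = δ` exist, and `prof_{ℓ,i}(r) r^ℓ = L_i(K(r·))`
(terms of degree `> ℓ` vanish by `htop`, the radial part is constant on spheres), giving
`|prof_{ℓ,i}(r)| r^ℓ ≤ A · sup_{‖x‖=r} |K x| ≤ A C (1 + r^(−a))`; (4) comparing, `r^(−ℓ−2) ≲ 1 + r^(−a)` as `r → 0`,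
i.e. `ℓ + 2 ≤ a`. (With `ℓ = 8`, `ρ = δ_{m²}`: `(Σ∂⁴)² G_m ∼ H₈(x) r^(−18)`, order exactly 10 — the crux's threshold
witness.) Leans on: Mathlib linear algebra (`Module.Dual`/`LinearIndependent` ⇒ dual family realised by point
evaluations: `exists_linearIndependent` on evaluation functionals), `MeasureTheory.lintegral` monotonicity,
`Real.rpow` asymptotics; the pointedness lemma is elementary polynomial algebra over `MvPolynomial (Fin 4) ℝ`. -/
theorem stub_orderLaw (a : ℝ) (K : E4 → ℝ) (d : DKLData) (ℓ : ℕ) (ha : 0 < a)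
    (hK : Hyp16 a K) (hd : d.Represents K) (hℓ : 1 ≤ ℓ)
    (htop : ∀ ℓ' : ℕ, ℓ < ℓ' → ∀ i : Fin (d.m ℓ'), d.ρp ℓ' i = d.ρm ℓ' i)
    (hsign : OneSignedFamily (d.H ℓ) (d.ρp ℓ) (d.ρm ℓ))
    (hne : ∃ i : Fin (d.m ℓ), d.ρp ℓ i ≠ d.ρm ℓ i) :
    (ℓ : ℝ) + 2 ≤ a := by
  sorry

/-! ## Composition (sorry-free) -/

/-- Glue (arrow form): every anisotropic spectral weight of a dressed-KL representation of a 16-RP kernel with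
exponent `a < 10` vanishes — downward induction on the degree: at the top degree `ℓ` the family is one-signed
(stub 3); if some weight is nonzero then `ℓ ≥ 8` contradicts the order law `ℓ + 2 ≤ a < 10` (stub 5) and
`ℓ ≤ 7` contradicts the sign test (stub 4). -/
theorem anisotropic_vanish (a : ℝ) (K : E4 → ℝ) (d : DKLData) (ha : 0 < a) (ha' : a < 10)
    (hK : Hyp16 a K) (hd : d.Represents K) :
    ∀ ℓ, 1 ≤ ℓ → ∀ i : Fin (d.m ℓ), d.ρp ℓ i = d.ρm ℓ i := by
  suffices h : ∀ k ℓ : ℕ, 1 ≤ ℓ → d.D + 1 ≤ ℓ + k → ∀ i : Fin (d.m ℓ), d.ρp ℓ i = d.ρm ℓ i from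
    fun ℓ hℓ => h (d.D + 1) ℓ hℓ (by omega)
  intro k
  induction k with
  | zero =>
    intro ℓ hℓ hD i
    have hm : d.m ℓ = 0 := hd.m_above ℓ (by omega)
    exact absurd i.is_lt (by omega)
  | succ k ih =>
    intro ℓ hℓ hD i
    by_cases hlt : d.D + 1 ≤ ℓ + k
    · exact ih ℓ hℓ hlt i
    have htop : ∀ ℓ' : ℕ, ℓ < ℓ' → ∀ i' : Fin (d.m ℓ'), d.ρp ℓ' i' = d.ρm ℓ' i' :=
      fun ℓ' hℓ' i' => ih ℓ' (by omega) (by omega) i'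
    have hsign := stub_topShellSign a K d ℓ ha hK hd hℓ htop
    by_contra hne
    by_cases h8 : 8 ≤ ℓ
    · have hle := stub_orderLaw a K d ℓ ha hK hd hℓ htop hsign ⟨i, hne⟩
      have h8' : (8 : ℝ) ≤ (ℓ : ℝ) := by exact_mod_cast h8
      linarith
    · exact hne (stub_lowDegreeVanish ℓ hℓ (by omega) (d.H ℓ) (hd.invHarm ℓ)
        (hd.linIndep ℓ) (d.ρp ℓ) (d.ρm ℓ) (hd.weight ℓ) hsign i)

/-- Glue (arrow form): a represented kernel all of whose anisotropic weights vanish equals its radial part. -/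
theorem radial_of_vanish (K : E4 → ℝ) (d : DKLData) (hd : d.Represents K)
    (hvan : ∀ ℓ, 1 ≤ ℓ → ∀ i : Fin (d.m ℓ), d.ρp ℓ i = d.ρm ℓ i) :
    ∀ y : E4, y ≠ 0 → K y = d.radial ‖y‖ := by
  intro y hy
  rw [hd.eq y hy]
  have hz : (∑ ℓ ∈ Finset.range (d.D + 1), ∑ i : Fin (d.m ℓ),
      MvPolynomial.eval (fun μ => y μ) (d.H ℓ i) * d.prof ℓ i ‖y‖) = 0 := by
    refine Finset.sum_eq_zero fun ℓ _ => Finset.sum_eq_zero fun i _ => ?_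
    rcases Nat.eq_zero_or_pos ℓ with rfl | hpos
    · have h0 := hd.m_zero
      exact absurd i.is_lt (by omega)
    · simp [DKLData.prof, hvan ℓ hpos i]
  rw [hz, add_zero]

/-- **Transfer target `C⁺ = BandLimitedShellRigidity` (the card's `Transfer:`), arrow form, from stubs 2–5:**
a band-limited kernel with `Hyp16 a K`, `0 < a < 10`, is radial off the origin. -/
theorem bandLimited_radial (a : ℝ) (K : E4 → ℝ) (ha : 0 < a) (ha' : a < 10) (hK : Hyp16 a K)
    (hb : IsBandLimited 18 K) : ∀ (R : E4 ≃ₗᵢ[ℝ] E4) (x : E4), x ≠ 0 → K (R x) = K x := by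
  intro R x hx
  obtain ⟨d, hd⟩ := stub_dressedKL a K ha hK hb
  have key := radial_of_vanish K d hd (anisotropic_vanish a K d ha ha' hK hd)
  have hRx : R x ≠ 0 := fun h => hx (by simpa using congrArg R.symm h)
  rw [key (R x) hRx, key x hx, LinearIsometryEquiv.norm_map]

/-- **The skeleton: `PencilRigidity.ShellRigidity` from the six stubs** (by name, no hypotheses; the only
sorries are inside `stub_*`). -/
theorem ShellRigidity_of : ShellRigidity := by
  intro K h1 h2 h3 h4 h5 R x hx
  obtain ⟨a, ha, ha', hK⟩ := stub_uvExponentWindow K h1 h2 h3 h4 h5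
  exact bandLimited_radial a K ha ha' hK (stub_bandLimit a K ha ha' hK) R x hx

end Summit.QuantumFields.YangMills.Cruxes.ShellRigidity.NullFamilySignTest
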